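import Summits.RiemannHypothesis.RiemannHypothesis.Theorems.NymanBeurlingKernelGram
import Summits.RiemannHypothesis.RiemannHypothesis.Theorems.NymanBeurlingCertificate
import Literature.Analysis.ValidatedNumerics.MatrixEigenEnclosure
import HarnessLib

/-!
# RiemannHypothesis / Nyman–Beurling — KERNEL LINEAGE K, part 2: the certificate checker and its soundness

Column LI/NB, rung L-D (b) → L-P(P2), PROOF-OF-DATA for cell `pub/rh-li` [rh-li-eng-3].  A certificate for the tier `M`
is LITERAL INTEGER DATA (`Cert`): a rounded Cholesky factor `Z/2^P` of `G_M − (λ + slack)·I`, the form bound `λ = lamN/2^LP`,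
one trial vector `y_N/2^TB` per `N ≤ M`, and the CLAIMS `dlo_N/S ≤ d_N² ≤ dhi_N/S`, `|y_{N,k}/2^TB − c⋆_{N,k}| ≤ rad_N/S`.
The checker `certCheck` (a closed Boolean, evaluated by `decide +kernel` in part 3) recomputes the Gram matrix and right-hand
sides with part 1's interval programs and verifies

* `gershCheck`: Gershgorin dominance of the interval residual `G_M − ZZᵀ/2^{2P} − λI` (symmetrised, radii of the enclosures
  included) ⇒ `λ‖v‖² ≤ v·G_M v` (`form_bound_of_gershCheck`, via `mul_sqSum_le_quadForm_of_residual`);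
* `rowCheck N`: with `Q ∋ d²(ỹ_N) = 1 − 2b·ỹ + ỹ·Gỹ` and `R ≥ S²‖b − Gỹ‖²` from the enclosures, the three integer
  inequalities `Q.hi ≤ dhi_N`, `R·2^LP ≤ (Q.lo − dlo_N)·S·lamN`, `R·2^{2LP} ≤ rad_N²·lamN²`.

This file: the data format, the checker, and the soundness of the FORM BOUND (`form_bound_of_gershCheck`); part 3
(`NymanBeurlingKernelCertificateRows.lean`) proves the row claims and `certCheck_sound` from the tree's certificate logic
`nbDistSq_certificate_of_tier` (file `NymanBeurlingCertificate.lean`).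

RH-FREE: finite-dimensional linear algebra and interval arithmetic; nothing here bears on `d_N → 0` or on the truth of RH.
-/

-- D-0017: `Summit.<S>.<S>.…` is the designed namespace of a single-problem summit.
set_option linter.dupNamespace false

namespace Summit.RiemannHypothesis.RiemannHypothesis.Theorems.NbTheory

open Literature.NumberTheory.LFunctions
open Literature.Analysis.ValidatedNumerics Literature.Analysis.ValidatedNumerics.NumericsMP
open Finset
open scoped Matrix

namespace NbKernel

/-! ## Certificate data -/

/-- Engine parameters: scale `S`, series lengths for `log`, Machin `arctan`, `e^{iφ}`, and the number of squarings. -/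
structure Params where
  /-- fixed-point scale -/
  S : ℕ
  /-- terms of the `log(1−x)` series -/
  KLOG : ℕ
  /-- terms of the `arctan` series (Machin) -/
  KATAN : ℕ
  /-- Taylor terms of `e^{iφ}` -/
  KEXP : ℕ
  /-- squarings after the Taylor step -/
  KSQ : ℕ

/-- A certificate for the tier `M` (all entries integers; see the module docstring). -/
structure Cert where
  /-- tier -/
  M : ℕ
  /-- grid of the Cholesky factor -/
  P : ℕ
  /-- Cholesky factor numerators, row `i`, columns `m ≤ i` -/
  Z : List (List ℤ)
  /-- grid of the form bound -/
  LP : ℕ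
  /-- form bound numerator: `λ = lamN / 2^LP` -/
  lamN : ℕ
  /-- grid of the trial vectors -/
  TB : ℕ
  /-- trial vectors: `ys[N-1] = y_N` (length `N`), `ỹ_N = y_N / 2^TB` -/
  ys : List (List ℤ)
  /-- claimed lower bounds `dlo[N-1]/S ≤ d_N²` -/
  dlo : List ℤ
  /-- claimed upper bounds `d_N² ≤ dhi[N-1]/S` -/
  dhi : List ℤ
  /-- claimed coefficient radii `rad[N-1]/S` -/
  rad : List ℕ

/-- `y_{N,k}`. -/
def yget (c : Cert) (N k : ℕ) : ℤ := mget c.ys (N - 1) k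

/-- The trial vector `ỹ_N = y_N/2^TB` as a real vector on `Fin N`. -/
noncomputable def trial (c : Cert) (N : ℕ) : Fin N → ℝ := fun k ↦ ((yget c N k : ℤ) : ℝ) / 2 ^ c.TB

/-! ## The form bound: Gershgorin on the interval residual of a rounded Cholesky factor -/

/-- `Σ_{m<M} Z_{im} Z_{jm} = 2^{2P}·(ZZᵀ/2^{2P})_{ij}` (exact integer). -/
def zzT (c : Cert) (i j : ℕ) : ℤ := rsum c.M fun m ↦ mget c.Z i m * mget c.Z j m

/-- Enclosure of the residual entry `R_{ij} = G_{ij} − (ZZᵀ)_{ij}/2^{2P} − λ δ_{ij}`. -/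
def resEncl (prm : Params) (c : Cert) (G : List (List (Option MI))) (i j : ℕ) : Option MI :=
  match gget G i j with
  | some g =>
    if i = j then some ((g.sub (MI.ofFrac prm.S (zzT c i j) (2 ^ (2 * c.P)))).sub (MI.ofFrac prm.S c.lamN (2 ^ c.LP)))
    else some (g.sub (MI.ofFrac prm.S (zzT c i j) (2 ^ (2 * c.P))))
  | none => none

/-- `Σ_{j<n, j≠i} absHi(R_{ij})` (scaled by `S`; `none` if an entry is missing). -/
def offSum (prm : Params) (c : Cert) (G : List (List (Option MI))) (i : ℕ) : ℕ → Option ℤ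
  | 0 => some 0
  | n + 1 =>
    match offSum prm c G i n with
    | some s => if n = i then some s else
        match resEncl prm c G i n with
        | some r => some (s + r.absHi)
        | none => none
    | none => none

/-- Row `i` of the Gershgorin test: `Σ_{j≠i} absHi(R_{ij}) ≤ lo(R_{ii})`. -/
def gershRow (prm : Params) (c : Cert) (G : List (List (Option MI))) (i : ℕ) : Bool :=
  match resEncl prm c G i i, offSum prm c G i c.M with
  | some d, some s => decide (s ≤ d.lo)
  | _, _ => false

/-- The Gershgorin test for all rows `i < M`. -/
def gershCheck (prm : Params) (c : Cert) (G : List (List (Option MI))) : Bool := rall c.M (gershRow prm c G)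

/-! ## The per-`N` residual certificates -/

/-- `Σ_{k<n}` of optional interval terms (`none` if a term is missing). -/
def osum (f : ℕ → Option MI) : ℕ → Option MI
  | 0 => some ⟨0, 0⟩
  | n + 1 =>
    match osum f n, f n with
    | some a, some t => some (a.add t)
    | _, _ => none

/-- Product of an optional interval with an integer. -/
def omulInt (o : Option MI) (z : ℤ) : Option MI :=
  match o with
  | some g => some (g.mulInt z)
  | none => none

/-- Enclosure of `(G y_N)_k = Σ_{j<N} G_{kj} y_{N,j}`. -/
def gyEncl (c : Cert) (G : List (List (Option MI))) (N k : ℕ) : Option MI :=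
  osum (fun j ↦ omulInt (gget G k j) (yget c N j)) N

/-- Enclosure of `b·y_N = Σ_{k<N} b_k y_{N,k}`. -/
def byEncl (c : Cert) (B : List (Option MI)) (N : ℕ) : Option MI :=
  osum (fun k ↦ omulInt (lget B k) (yget c N k)) N

/-- Enclosure of `y_N·G y_N = Σ_{k<N} (G y_N)_k y_{N,k}`. -/
def ygyEncl (c : Cert) (G : List (List (Option MI))) (N : ℕ) : Option MI :=
  osum (fun k ↦ omulInt (gyEncl c G N k) (yget c N k)) N

/-- `Σ_{k<n} absHi(b_k − (G y_N)_k/2^TB)²` — `S²` times an upper bound of the squared residual norm. -/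
def resSq (prm : Params) (c : Cert) (G : List (List (Option MI))) (B : List (Option MI)) (N : ℕ) : ℕ → Option ℤ
  | 0 => some 0
  | k + 1 =>
    match resSq prm c G B N k, lget B k, gyEncl c G N k with
    | some s, some b, some t => some (s + (b.sub (t.divNat (2 ^ c.TB))).absHi ^ 2)
    | _, _, _ => none

/-- Enclosure of `d²(ỹ_N) = 1 − 2 b·ỹ_N + ỹ_N·G ỹ_N` from the two scaled sums. -/
def qEncl (prm : Params) (c : Cert) (l qd : MI) : MI :=
  ((MI.ofInt prm.S 1).sub ((l.mulInt 2).divNat (2 ^ c.TB))).add (qd.divNat (2 ^ (2 * c.TB)))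

/-- The three integer inequalities of row `N`. -/
def rowCheck (prm : Params) (c : Cert) (G : List (List (Option MI))) (B : List (Option MI)) (N : ℕ) : Bool :=
  match byEncl c B N, ygyEncl c G N, resSq prm c G B N N with
  | some l, some qd, some R =>
    decide ((qEncl prm c l qd).hi ≤ vget c.dhi (N - 1)) &&
      decide (R * 2 ^ c.LP ≤ ((qEncl prm c l qd).lo - vget c.dlo (N - 1)) * prm.S * c.lamN) &&
        decide (R * 2 ^ (2 * c.LP) ≤ ((vget c.rad (N - 1) : ℕ) : ℤ) ^ 2 * (c.lamN : ℤ) ^ 2)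
  | _, _, _ => false

/-- All rows `N = 1, …, M`. -/
def rowsCheck (prm : Params) (c : Cert) (G : List (List (Option MI))) (B : List (Option MI)) : Bool :=
  rall c.M fun n ↦ rowCheck prm c G B (n + 1)

/-- **The certificate checker** (closed Boolean; part 3 evaluates it with `decide +kernel`). -/
def certCheck (prm : Params) (c : Cert) : Bool :=
  match MI.pi prm.S prm.KATAN with
  | some piI =>
    match l2pigEncl prm.S prm.KLOG piI with
    | some c0 =>
      decide (0 < prm.S) && decide (0 < c.lamN) &&
        gershCheck prm c (gramTable prm.S c.M (cotTable prm.S prm.KEXP prm.KSQ c.M piI) (logTable prm.S prm.KLOG c.M) c0 piI) &&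
        rowsCheck prm c (gramTable prm.S c.M (cotTable prm.S prm.KEXP prm.KSQ c.M piI) (logTable prm.S prm.KLOG c.M) c0 piI)
          (rhsTable prm.S c.M (logTable prm.S prm.KLOG c.M))
    | none => false
  | none => false

/-! ## Soundness of the form bound -/

section Sound

variable {prm : Params} {c : Cert} {G : List (List (Option MI))} {B : List (Option MI)}

/-- Soundness hypothesis for a Gram table. -/
abbrev GramOK (prm : Params) (c : Cert) (G : List (List (Option MI))) : Prop :=
  ∀ j k, j < c.M → k < c.M → ∀ Y, gget G j k = some Y → MI.mem prm.S (nbGram j k) Y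

/-- Soundness hypothesis for a right-hand-side table. -/
abbrev RhsOK (prm : Params) (c : Cert) (B : List (Option MI)) : Prop :=
  ∀ k, k < c.M → ∀ Y, lget B k = some Y → MI.mem prm.S (nbRhs k) Y


/-- The real Cholesky factor `L_{im} = Z_{im}/2^P`. -/
noncomputable def lreal (c : Cert) (i m : ℕ) : ℝ := ((mget c.Z i m : ℤ) : ℝ) / 2 ^ c.P

/-- The real residual `R = G − L Lᵀ − λ I` (as an `ℕ`-indexed table). -/
noncomputable def rreal (c : Cert) (i j : ℕ) : ℝ :=
  Literature.Analysis.ValidatedNumerics.residual c.M (fun i j ↦ nbGram i j) (lreal c) (fun _ ↦ 1)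
    ((c.lamN : ℝ) / 2 ^ c.LP) i j

/-- `(L·1·Lᵀ)_{ij} = (ZZᵀ)_{ij}/2^{2P}`. -/
theorem ldlt_eq (c : Cert) (i j : ℕ) :
    ldlt c.M (lreal c) (fun _ ↦ 1) i j = ((zzT c i j : ℤ) : ℝ) / ((2 ^ (2 * c.P) : ℕ) : ℝ) := by
  unfold ldlt zzT lreal
  rw [rsum_eq_sum]
  push_cast
  rw [Finset.sum_div]
  refine Finset.sum_congr rfl fun m _ ↦ ?_
  rw [pow_mul']
  ring

/-- `ZZᵀ` is symmetric. -/
theorem zzT_comm (c : Cert) (i j : ℕ) : zzT c i j = zzT c j i := by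
  unfold zzT; simp_rw [mul_comm (mget c.Z i _) (mget c.Z j _)]

/-- The residual is symmetric. -/
theorem rreal_comm (c : Cert) (i j : ℕ) : rreal c i j = rreal c j i := by
  unfold rreal Literature.Analysis.ValidatedNumerics.residual
  rw [ldlt_eq, ldlt_eq, zzT_comm]
  simp only [KappaZeroth.nbGram_comm i j]
  by_cases h : i = j
  · subst h; rfl
  · rw [if_neg h, if_neg (Ne.symm h)]

/-- `R_{ij} ∈ resEncl i j` whenever the Gram table is sound at `(i,j)`. -/
theorem mem_resEncl (hG : GramOK prm c G) {i j : ℕ} (hi : i < c.M) (hj : j < c.M) {Y : MI} (h : resEncl prm c G i j = some Y) :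
    MI.mem prm.S (rreal c i j) Y := by
  unfold resEncl at h
  split at h
  · rename_i g hg
    have mg := hG i j hi hj g hg
    have mz := MI.mem_ofFrac prm.S (zzT c i j) (q := 2 ^ (2 * c.P)) (by positivity)
    have ml := MI.mem_ofFrac prm.S (c.lamN : ℤ) (q := 2 ^ c.LP) (by positivity)
    unfold rreal Literature.Analysis.ValidatedNumerics.residual
    rw [ldlt_eq]
    split_ifs at h with hij
    · simp only [Option.some.injEq] at h; subst h
      rw [if_pos hij]
      have := MI.mem_sub (MI.mem_sub mg mz) ml
      convert this using 2
      push_cast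
      ring
    · simp only [Option.some.injEq] at h; subst h
      rw [if_neg hij, sub_zero]
      exact MI.mem_sub mg mz
  · simp at h

/-- `offSum i n = some s` bounds the symmetrised off-diagonal sum of row `i` over `j < n`. -/
theorem offDiag_le_of_offSum (hS : 0 < prm.S) (hG : GramOK prm c G) {i : ℕ} (hi : i < c.M) :
    ∀ (n : ℕ) (s : ℤ), n ≤ c.M → offSum prm c G i n = some s →
      (∑ j ∈ Finset.range n, if j = i then (0 : ℝ) else (|rreal c i j| + |rreal c j i|) / 2) ≤ (s : ℝ) / prm.S
  | 0, s, _, h => by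
    simp only [offSum, Option.some.injEq] at h
    subst h; simp
  | n + 1, s, hn, h => by
    simp only [offSum] at h
    split at h
    · rename_i s' hs'
      have ih := offDiag_le_of_offSum hS hG hi n s' (by omega) hs'
      rw [Finset.sum_range_succ]
      split_ifs at h with hni
      · simp only [Option.some.injEq] at h; subst h
        rw [if_pos hni, add_zero]; exact ih
      · split at h
        · rename_i r hr
          simp only [Option.some.injEq] at h; subst h
          rw [if_neg hni]
          have mr := mem_resEncl hG hi (by omega) hr
          have hSr : (0 : ℝ) < prm.S := by exact_mod_cast hS
          have hab := MI.abs_le_absHi mr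
          rw [← rreal_comm c i n, ← two_mul, mul_div_cancel_left₀ _ (two_ne_zero)]
          have : |rreal c i n| ≤ ((r.absHi : ℤ) : ℝ) / prm.S := by
            rw [le_div_iff₀ hSr]; exact hab
          push_cast
          rw [add_div]
          exact add_le_add ih this
        · simp at h
    · simp at h

/-- **Form bound from the Gershgorin test (RH-FREE)**: `λ‖v‖² ≤ v·G_M v` for every real `v`. -/
theorem form_bound_of_gershCheck (hS : 0 < prm.S) (hG : GramOK prm c G) (h : gershCheck prm c G = true)
    (v : Fin c.M → ℝ) :
    ((c.lamN : ℝ) / 2 ^ c.LP) * ∑ i, v i ^ 2 ≤ v ⬝ᵥ (nbGramMatrix c.M *ᵥ v) := by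
  have hSr : (0 : ℝ) < prm.S := by exact_mod_cast hS
  have hsq : ∑ i, v i ^ 2 = sqSum c.M (padV v) := by
    rw [sqSum_pad]; simp [dotProduct, sq]
  have hqf : v ⬝ᵥ (nbGramMatrix c.M *ᵥ v) = quadForm c.M (fun i j ↦ nbGram i j) (padV v) := by
    rw [← quadForm_pad]
    refine (quadForm_congr (fun i hi j hj ↦ ?_) (fun i _ ↦ rfl)).symm
    rw [padM_of_lt _ hi hj]; rfl
  rw [hsq, hqf]
  refine mul_sqSum_le_quadForm_of_residual (k := c.M) (C := fun i j ↦ nbGram i j)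
    (Δ := fun _ _ ↦ 0) (L := lreal c) (D := fun _ ↦ 1) (fun _ _ ↦ zero_le_one) (fun i _ j _ ↦ by simp) ?_ _
  intro i hi
  have hi' := Finset.mem_range.1 hi
  unfold gershCheck at h
  have hrow := of_rall h hi'
  unfold gershRow at hrow
  split at hrow
  · rename_i d s hd hs
    rw [decide_eq_true_eq] at hrow
    have hoff := offDiag_le_of_offSum hS hG hi' c.M s le_rfl hs
    have hdiag := MI.lo_div_le hS (mem_resEncl hG hi' hi' hd)
    have hrad : radRow c.M (fun _ _ ↦ (0 : ℝ)) i = 0 := by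
      simp [radRow]
    have hsd : (s : ℝ) / prm.S ≤ (d.lo : ℝ) / prm.S :=
      div_le_div_of_nonneg_right (by exact_mod_cast hrow) hSr.le
    rw [hrad, add_zero]
    change Literature.Analysis.ValidatedNumerics.offDiag c.M (rreal c) i ≤ rreal c i i
    unfold Literature.Analysis.ValidatedNumerics.offDiag
    linarith
  · simp at hrow

end Sound

end NbKernel

end Summit.RiemannHypothesis.RiemannHypothesis.Theorems.NbTheory
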